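import Summits.ResolutionOfSingularities.ResolutionOfSingularities.Theorems.FrobeniusClosingPatchingRelPerfectConeDepthSmoothQuadricCharts
import Summits.ResolutionOfSingularities.ResolutionOfSingularities.Theorems.FrobeniusClosingPatchingRelPerfectConeDepthQuadricRung
import Literature.RingTheory.HilbertSamuel.PhiLowerBound
import HarnessLib

/-!
# Crux `PatchingRelPerfect` (stmt-ResolutionOfSingularities-16161), chain W5.2 — RUNG «r-smooth-quadric-ℓ» BY NAME: a quadratic
# form with SMOOTH reduced quadric at every exceptional depth, `(Q(x)) + 𝔪^{ℓ+2} ∈ 𝒞` — arbitrary coefficients, one blowing up, END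

[OURS · L1 W5.2 · rung tool] Replaces the role of NO printed item; NOT a statement of the manuscript under review; fact-free,
any characteristic, any residue field, no completeness, no coefficient field.  AI-written (AI review is weaker than expert review).

`S` regular local of dimension `4`, `x₀, …, x₃` a regular system of parameters, `Q ∈ S[T₀, …, T₃]` a form of degree `2` whose
REDUCED form `Q̄ ∈ κ[T]` cuts a SMOOTH quadric surface `V(Q̄) ⊂ ℙ³_κ` — hypothesis, chart by chart: `(F_i, ∂F_i/∂T_j) = (1)` for
`F_i = Q̄|_{T_i = 1}` (`ConeDepth.chartPoly`).  THEN for EVERY `ℓ` the member `I = (Q(x)) + 𝔪^{ℓ+2}` lies in the companion class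
`𝒞` and satisfies the blow-up-form core conclusion (`smoothQuadricRung_of_ringKrullDim`; core dress `atomDimFourBlowupAt_smoothQuadric`).
Route = the route of g4's split rung «r-quadric-ℓ» (`quadricRung_of_ringKrullDim`, `Q = T₀T₁ + T₂T₃`) with the graph argument
replaced by the Jacobian criterion at an arbitrary prime (`smoothQuadChart`): ONE blowing up of the closed point makes the host
regular and transversal to the exceptional divisor at every point over the closed point (`smoothQuadric_fibre`), the format is
`I𝒪_{X₁} = 𝓘_{E₁}² · ((𝓗₁,1)(E₁,0) ⊔ (𝓗₁,0)(E₁,ℓ))` (`smoothQuadric_format`), and the END `coneEndCompanion` applies.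
New coverage (beyond the split quadric): the NON-SPLIT nondegenerate quadrics `x₀x₁ + N(x₂, x₃)` (`N` anisotropic binary) and the
anisotropic quaternary forms — the isometry types of `d = 2` one-form graded members invisible over an algebraically closed field.

## References
* J. Kollár, *Lectures on Resolution of Singularities* (2007), Def. 3.24, 3.61, (3.111) Step 3. [Kollar2007]
* H. Matsumura, *Commutative Ring Theory*, CUP 1986, Thm. 14.2, Thm. 30.3. [Matsumura1987]
* The Stacks Project, Tags 0804, 080A, 0BIQ. [StacksProject]
* R. Hartshorne, *Algebraic Geometry*, Springer 1977, II Prop. 5.1 (b). [Hartshorne1977]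
-/

set_option linter.dupNamespace false

noncomputable section

open CategoryTheory CategoryTheory.Limits AlgebraicGeometry TopologicalSpace IsLocalRing
open Literature.AlgebraicGeometry.Resolution
open Scheme.IdealSheafData
open scoped Pointwise

namespace Summit.ResolutionOfSingularities.ResolutionOfSingularities.Theorems

universe u

namespace ConeDepth

/-! ## Base change of the evaluation of a form -/

/-- `g(Q(x)) = Q^g(g ∘ x)` for a ring homomorphism `g`. [folklore] -/
theorem map_eval_eq_eval_map {S R : Type u} [CommRing S] [CommRing R] (g : S →+* R) {n : ℕ} (x : Fin n → S)
    (Q : MvPolynomial (Fin n) S) :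
    g (MvPolynomial.eval x Q) = MvPolynomial.eval (fun j => g (x j)) (MvPolynomial.map g Q) := by
  have h : g.comp (MvPolynomial.eval x) = (MvPolynomial.eval (fun j => g (x j))).comp (MvPolynomial.map g) := by
    refine MvPolynomial.ringHom_ext (fun r => ?_) (fun j => ?_)
    · simp only [RingHom.comp_apply, MvPolynomial.eval_C, MvPolynomial.map_C]
    · simp only [RingHom.comp_apply, MvPolynomial.eval_X, MvPolynomial.map_X]
  exact RingHom.congr_fun h Q

/-! ## The smooth quadric fibre theorem: blowing up the singular point of a form with smooth reduced quadric -/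

section SmoothQuadricFibre

variable {X' X : Scheme.{u}} {σ : X' ⟶ X} {J : X.IdealSheafData}
  (hσ : IsBlowup σ J) (z : X) (c : Fin 4 → X.presheaf.stalk z) [IsRegularLocalRing (X.presheaf.stalk z)]
  (hz𝔪 : Ideal.span (Set.range c) = maximalIdeal (X.presheaf.stalk z))
  (hd : (maximalIdeal (X.presheaf.stalk z)).spanFinrank = 4)
  (hJ : stalkIdeal J z = maximalIdeal (X.presheaf.stalk z))
  (Q : MvPolynomial (Fin 4) (X.presheaf.stalk z)) (hQ : Q.IsHomogeneous 2)
  (hsm : ∀ i, Ideal.span (insert (chartPoly Q i) (Set.range fun t => MvPolynomial.pderiv t (chartPoly Q i))) = ⊤)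
  (𝓗 : X.IdealSheafData) (h𝓗 : stalkIdeal 𝓗 z = Ideal.span {MvPolynomial.eval c Q})
  (q : (j : Fin 4) → (Spec (.of (chartRing c j)) ⟶ X'))
  (hqσ : ∀ j, q j ≫ σ = Spec.map (CommRingCat.ofHom (chartBase c j)) ≫ X.fromSpecStalk z)
  (hqiso : ∀ j (w : Spec (.of (chartRing c j))), IsIso ((q j).stalkMap w))

include hσ hz𝔪 hd hJ hQ hsm h𝓗 hqσ hqiso in
/-- **A point of the fibre on a chart**: at every point `x' = q_j(w)` over `z` the list `[σᶜ(𝓗,2), J𝒪_{X'}]` has simple normal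
crossings — the reduced chart polynomial `F_j` being smooth, `smoothQuadChart` provides the adapted regular system of parameters.
[cite: Kollar2007, Def. 3.24] [cite: Matsumura1987, Thm. 30.3] -/
theorem sncWithAt_smoothQuadChart (j : Fin 4) (w : PrimeSpectrum (chartRing c j)) (x' : X') (hx' : q j w = x') (hz' : σ x' = z) :
    DepthSNC.SNCWithAt [controlledTransform σ J 𝓗 2, J.comap σ] ⊤ x' := by
  classical
  have hc := span_eq_stalkIdeal_centre z c hz𝔪 hJ
  haveI := hqiso j w
  obtain ⟨χ, hχ, hloc, hw𝔪⟩ := exists_stalk_presentation c j (q j) (hqσ j) w hx' hz'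
  letI : Algebra (chartRing c j) (X'.presheaf.stalk x') := χ.toAlgebra
  haveI := hloc
  have hnzd : χ (chartBase c j (c j)) ∈ nonZeroDivisors (X'.presheaf.stalk x') :=
    algebraMap_centre_mem_nonZeroDivisors c j (X'.presheaf.stalk x') (chartBase c j)
      (reesChartBase_mem_nonZeroDivisors (c j) (Ideal.mem_span_range_self (f := c) (x := j))) w.asIdeal
  have hstE : stalkIdeal (J.comap σ) x' = Ideal.span {χ (chartBase c j (c j))} :=
    stalkIdeal_exceptional_of_presentation χ hz' hχ hc
  have hstH : stalkIdeal (controlledTransform σ J 𝓗 2) x' = Ideal.span {χ (chartForm Q c j)} :=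
    stalkIdeal_controlledTransform_of_presentation χ hz' hχ hσ hc hnzd 𝓗 _ h𝓗 2 (chartForm Q c j)
      (by rw [chartBase_eval_eq Q c j hQ, map_mul, map_pow])
  have hne := chartForm_ne_chartBase Q c hz𝔪 hd j (chartPoly_ne_zero_of_smooth Q j (hsm j))
  have key : DepthSNC.SNCWithAt ([(J.comap σ, chartBase c j (c j)), (controlledTransform σ J 𝓗 2, chartForm Q c j)].map Prod.fst)
      ⊤ x' := by
    refine sncWithAt_of_adapted χ w.asIdeal hloc _ ?_ ?_ ?_
    · intro p hp
      simp only [List.mem_cons, List.not_mem_nil, or_false] at hp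
      rcases hp with rfl | rfl
      · exact hstE
      · exact hstH
    · intro p hp p' hp' h
      simp only [List.mem_cons, List.not_mem_nil, or_false] at hp hp'
      rcases hp with rfl | rfl <;> rcases hp' with rfl | rfl
      · rfl
      · exact absurd h.symm hne
      · exact absurd h hne
      · rfl
    · exact smoothQuadChart Q c hz𝔪 hd j w.asIdeal hw𝔪 (X'.presheaf.stalk x') (hsm j)
  refine key.anti fun D hD _ => ?_
  simp only [List.mem_cons, List.not_mem_nil, or_false] at hD
  simp only [List.map_cons, List.map_nil, List.mem_cons, List.not_mem_nil, or_false]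
  rcases hD with rfl | rfl
  · exact Or.inr rfl
  · exact Or.inl rfl

end SmoothQuadricFibre

/-- **THE SMOOTH QUADRIC FIBRE THEOREM.**  Blow up a point `z` of a scheme `X` (`σ` a blowing up along `J` with `J_z = 𝔪_z`)
where `𝒪_{X,z}` is regular of dimension `4` with regular system of parameters `c`, and follow the host `𝓗_z = (Q(c))` for a
form `Q` of degree `2` over `𝒪_{X,z}` whose reduced quadric `V(Q̄) ⊂ ℙ³_{κ(z)}` is smooth (`(F_i, ∂F_i) = (1)` on every chart):
at EVERY point over `z` the weight-`2` controlled transform of `𝓗` and the exceptional divisor have simple normal crossings (the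
projectivised tangent cone `V(Q̄)` is a smooth quadric surface — possibly without rational points). [cite: Kollar2007, 3.61]
[cite: StacksProject, Tag 0804] -/
theorem smoothQuadric_fibre {X' X : Scheme.{u}} {σ : X' ⟶ X} {J : X.IdealSheafData} (hσ : IsBlowup σ J) (z : X)
    (c : Fin 4 → X.presheaf.stalk z) [IsRegularLocalRing (X.presheaf.stalk z)]
    (hz𝔪 : Ideal.span (Set.range c) = maximalIdeal (X.presheaf.stalk z))
    (hd : (maximalIdeal (X.presheaf.stalk z)).spanFinrank = 4)
    (hJ : stalkIdeal J z = maximalIdeal (X.presheaf.stalk z))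
    (Q : MvPolynomial (Fin 4) (X.presheaf.stalk z)) (hQ : Q.IsHomogeneous 2)
    (hsm : ∀ i, Ideal.span (insert (chartPoly Q i) (Set.range fun t => MvPolynomial.pderiv t (chartPoly Q i))) = ⊤)
    (𝓗 : X.IdealSheafData) (h𝓗 : stalkIdeal 𝓗 z = Ideal.span {MvPolynomial.eval c Q}) :
    ∀ x' : X', σ x' = z → DepthSNC.SNCWithAt [controlledTransform σ J 𝓗 2, J.comap σ] ⊤ x' := by
  classical
  obtain ⟨q, hqσ, hqiso, hcov⟩ := exists_charts_over hσ z c (span_eq_stalkIdeal_centre z c hz𝔪 hJ)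
  intro x' hx'
  obtain ⟨j, w, hqw⟩ := hcov x' hx'
  exact sncWithAt_smoothQuadChart hσ z c hz𝔪 hd hJ Q hQ hsm 𝓗 h𝓗 q hqσ hqiso j w x' hqw hx'

/-! ## The rung «r-smooth-quadric-ℓ»: one blowing up of the closed point, then the END -/

section SmoothQuadricRung

variable {S : Type u} [CommRing S] [IsRegularLocalRing S]
  (x : Fin 4 → S) (hx : Ideal.span (Set.range x) = maximalIdeal S) (hdim : ringKrullDim S = (4 : ℕ))
  (Q : MvPolynomial (Fin 4) S) (hQ : Q.IsHomogeneous 2)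
  (hsm : ∀ i, Ideal.span (insert (chartPoly Q i) (Set.range fun t => MvPolynomial.pderiv t (chartPoly Q i))) = ⊤) (ℓ : ℕ)

include hx hdim hQ hsm in
/-- **Simple normal crossings on the first blowing up**: on `X₁ = Bl_𝔪 Spec S` the strict transform `𝓗₁ = σ₁ᶜ((Q(x))~, 2)` of a
form with smooth reduced quadric and the exceptional divisor have simple normal crossings at every point over the closed point
(`smoothQuadric_fibre` at the closed point of `Spec S`; the form and its smoothness certificate are moved to `𝒪_{Spec S, 𝔪} = S_𝔪`
along the local structure map). [cite: Kollar2007, 3.61] [cite: Hartshorne1977, II Prop. 5.1 (b)] -/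
theorem smoothQuadric_sncWithAt_blowup :
    ∀ y : blowup (affineBlowup.idealSheaf (maximalIdeal S)),
      blowup.π (affineBlowup.idealSheaf (maximalIdeal S)) y = IsLocalRing.closedPoint S →
    DepthSNC.SNCWithAt
      [controlledTransform (blowup.π (affineBlowup.idealSheaf (maximalIdeal S))) (affineBlowup.idealSheaf (maximalIdeal S))
          (affineBlowup.idealSheaf (Ideal.span {MvPolynomial.eval x Q})) 2,
        (affineBlowup.idealSheaf (maximalIdeal S)).comap (blowup.π (affineBlowup.idealSheaf (maximalIdeal S)))] ⊤ y := by
  classical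
  haveI : IsRegularRing S := isRegularRing_of_isRegularLocalRing S
  set J₀ : (Spec (.of S)).IdealSheafData := affineBlowup.idealSheaf (maximalIdeal S) with hJ₀
  have hσ : IsBlowup (blowup.π J₀) J₀ := blowup.isBlowup J₀
  let z₀ : Spec (.of S) := IsLocalRing.closedPoint S
  letI : Algebra S ((Spec (.of S)).presheaf.stalk z₀) :=
    inferInstanceAs (Algebra S ((Spec.structureSheaf S).presheaf.stalk z₀))
  haveI : IsLocalization.AtPrime ((Spec (.of S)).presheaf.stalk z₀) (maximalIdeal S) :=
    inferInstanceAs (IsLocalization.AtPrime ((Spec.structureSheaf S).presheaf.stalk z₀) z₀.asIdeal)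
  haveI hregA : IsRegularLocalRing ((Spec (.of S)).presheaf.stalk z₀) := Scheme.isRegular_Spec (.of S) z₀
  -- the local structure map `S → S_𝔪` is local
  haveI : IsLocalHom (algebraMap S ((Spec (.of S)).presheaf.stalk z₀)) := ⟨fun a ha => by
    have h := (IsLocalization.AtPrime.isUnit_to_map_iff ((Spec (.of S)).presheaf.stalk z₀) (maximalIdeal S) a).mp ha
    exact (IsLocalRing.notMem_maximalIdeal).mp h⟩
  have hmaxA : maximalIdeal ((Spec (.of S)).presheaf.stalk z₀) =
      (maximalIdeal S).map (algebraMap S ((Spec (.of S)).presheaf.stalk z₀)) :=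
    (IsLocalization.AtPrime.map_eq_maximalIdeal (maximalIdeal S) _).symm
  have hdimA : ringKrullDim ((Spec (.of S)).presheaf.stalk z₀) = (4 : ℕ) := by
    rw [IsLocalization.AtPrime.ringKrullDim_eq_height (maximalIdeal S) ((Spec (.of S)).presheaf.stalk z₀),
      IsLocalRing.maximalIdeal_height_eq_ringKrullDim, hdim]
  have hdA : (maximalIdeal ((Spec (.of S)).presheaf.stalk z₀)).spanFinrank = 4 := by
    have h := IsRegularLocalRing.spanFinrank_maximalIdeal (R := (Spec (.of S)).presheaf.stalk z₀)
    rw [hdimA] at h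
    exact_mod_cast h
  let c : Fin 4 → (Spec (.of S)).presheaf.stalk z₀ := fun i => algebraMap S _ (x i)
  have hc : Ideal.span (Set.range c) = maximalIdeal ((Spec (.of S)).presheaf.stalk z₀) := by
    rw [show Set.range c = algebraMap S ((Spec (.of S)).presheaf.stalk z₀) '' Set.range x from (Set.range_comp _ x),
      ← Ideal.map_span, hx, hmaxA]
  have hJ : stalkIdeal J₀ z₀ = maximalIdeal ((Spec (.of S)).presheaf.stalk z₀) :=
    stalkIdeal_idealSheaf_maximalIdeal_closedPoint
  -- the form over the stalk
  let Q' : MvPolynomial (Fin 4) ((Spec (.of S)).presheaf.stalk z₀) :=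
    MvPolynomial.map (algebraMap S ((Spec (.of S)).presheaf.stalk z₀)) Q
  have hQ' : Q'.IsHomogeneous 2 := hQ.map _
  have hsm' : ∀ i, Ideal.span (insert (chartPoly Q' i) (Set.range fun t => MvPolynomial.pderiv t (chartPoly Q' i))) = ⊤ :=
    fun i => span_chartPoly_pderiv_eq_top_map Q i (algebraMap S ((Spec (.of S)).presheaf.stalk z₀)) (hsm i)
  have heval : algebraMap S ((Spec (.of S)).presheaf.stalk z₀) (MvPolynomial.eval x Q) = MvPolynomial.eval c Q' :=
    map_eval_eq_eval_map (algebraMap S ((Spec (.of S)).presheaf.stalk z₀)) x Q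
  have hH₀ : stalkIdeal (affineBlowup.idealSheaf (Ideal.span {MvPolynomial.eval x Q})) z₀ =
      Ideal.span {MvPolynomial.eval c Q'} := by
    rw [DepthTargets.stalkIdeal_idealSheaf_eq, Ideal.map_span, Set.image_singleton]
    exact congrArg (fun t => Ideal.span {t}) heval
  intro y hy
  exact smoothQuadric_fibre hσ z₀ c hc hdA hJ Q' hQ' hsm' _ hH₀ y hy

include hx hQ in
/-- **The format on the first blowing up**: `I𝒪_{X₁} = 𝓘_{E₁}² · ((𝓗₁,1)(E₁,0) ⊔ (𝓗₁,0)(E₁,ℓ))` for `I = (Q(x)) + 𝔪^{ℓ+2}`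
(`Q(x) ∈ 𝔪²` by the tree's `eval_mem_pow_of_isHomogeneous`). [cite: BierstoneGrigorievMilmanWlodarczyk2011, §3.2 Lemma 3.2.1] -/
theorem smoothQuadric_format {X₁ : Scheme.{u}} {σ : X₁ ⟶ Spec (.of S)}
    (hσ : IsBlowup σ (affineBlowup.idealSheaf (maximalIdeal S))) :
    (affineBlowup.idealSheaf (Ideal.span {MvPolynomial.eval x Q} ⊔ maximalIdeal S ^ (ℓ + 2))).comap σ =
      (affineBlowup.idealSheaf (maximalIdeal S)).comap σ ^ 2 *
        (monomialIdeal [(controlledTransform σ (affineBlowup.idealSheaf (maximalIdeal S))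
            (affineBlowup.idealSheaf (Ideal.span {MvPolynomial.eval x Q})) 2, 1),
            ((affineBlowup.idealSheaf (maximalIdeal S)).comap σ, 0)] ⊔
          monomialIdeal [(controlledTransform σ (affineBlowup.idealSheaf (maximalIdeal S))
            (affineBlowup.idealSheaf (Ideal.span {MvPolynomial.eval x Q})) 2, 0),
            ((affineBlowup.idealSheaf (maximalIdeal S)).comap σ, ℓ)]) := by
  have hH : (affineBlowup.idealSheaf (maximalIdeal S)).comap σ ^ 2 *
      controlledTransform σ (affineBlowup.idealSheaf (maximalIdeal S))
        (affineBlowup.idealSheaf (Ideal.span {MvPolynomial.eval x Q})) 2 =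
      (affineBlowup.idealSheaf (Ideal.span {MvPolynomial.eval x Q})).comap σ := by
    haveI : IsProper σ := hσ.isProper
    haveI : IsLocallyNoetherian X₁ := LocallyOfFiniteType.isLocallyNoetherian σ
    refine pow_mul_controlledTransform_eq σ _ hσ.isEffectiveCartier ?_
    rw [← comap_pow]
    refine Scheme.IdealSheafData.comap_mono σ ?_
    rw [← DepthOne.idealSheaf_pow]
    refine idealSheaf_mono ?_
    rw [Ideal.span_singleton_le_iff_mem]
    exact Literature.RingTheory.HilbertSamuel.eval_mem_pow_of_isHomogeneous x hx hQ
  rw [DepthTargets.idealSheaf_sup_eq, DepthOne.idealSheaf_pow, Scheme.IdealSheafData.comap_sup, comap_pow, ← hH]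
  simp only [monomialIdeal_cons, monomialIdeal_nil, pow_one, pow_zero, Scheme.IdealSheafData.one_eq_top,
    Scheme.IdealSheafData.mul_top, Scheme.IdealSheafData.top_mul]
  rw [← Scheme.IdealSheafData.add_eq_sup, ← Scheme.IdealSheafData.add_eq_sup]
  ring

include hx hdim hQ hsm in
/-- **RUNG «r-smooth-quadric-ℓ», UNCONDITIONAL PACKAGE**: for `S` regular local of dimension `4`, `x` spanning `𝔪`, a form `Q`
of degree `2` over `S` whose reduced quadric `V(Q̄) ⊂ ℙ³_κ` is SMOOTH (`(F_i, ∂F_i) = (1)` on every chart) and EVERY `ℓ`: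
(1) `(Q(x)) + 𝔪^{ℓ+2} ∈ 𝒞` (an `𝔪`-primary companion with a regular blowing up); (2) the blow-up-form core conclusion for every
`T = Bl_I Spec S`, `I = (Q(x)) + 𝔪^{ℓ+2}`.  One blowing up of the closed point (`smoothQuadric_format`,
`smoothQuadric_sncWithAt_blowup`), then the END `coneEndCompanion`.  Every characteristic, every residue field, arbitrary
coefficients (no coefficient field), no completeness, fact-free. [cite: Kollar2007, 3.61 and (3.111) Step 3] [cite: StacksProject, Tag 080A] -/
theorem smoothQuadricRung_of_ringKrullDim :
    (∃ (P : Ideal S) (m : ℕ), IsLocalRing.maximalIdeal S ^ m ≤ P ∧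
      ∃ (B' : Scheme.{u}) (b : B' ⟶ Spec (.of S)),
        IsBlowup b (affineBlowup.idealSheaf ((Ideal.span {MvPolynomial.eval x Q} ⊔ maximalIdeal S ^ (ℓ + 2)) * P)) ∧
        Scheme.IsRegular B') ∧
    (∀ (T : Scheme.{u}) (f : T ⟶ Spec (.of S)),
      IsBlowup f (affineBlowup.idealSheaf (Ideal.span {MvPolynomial.eval x Q} ⊔ maximalIdeal S ^ (ℓ + 2))) →
      ∃ (J : T.IdealSheafData) (T' : Scheme.{u}) (π : T' ⟶ T), J ≠ ⊥ ∧
        (∀ t : T, t ∈ J.support → f.base t = IsLocalRing.closedPoint S) ∧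
        IsBlowup π J ∧ Scheme.IsRegular T') := by
  classical
  have hd : (maximalIdeal S).spanFinrank = 4 := by
    have h := IsRegularLocalRing.spanFinrank_maximalIdeal (R := S)
    rw [hdim] at h
    exact_mod_cast h
  haveI : IsDomain S := isDomain_of_isRegularLocalRing S
  haveI : IsRegularRing S := isRegularRing_of_isRegularLocalRing S
  have h𝔪 : maximalIdeal S ≠ ⊥ := by
    intro h
    rw [h, Submodule.spanFinrank_bot] at hd
    exact absurd hd (by norm_num)
  have hI : Ideal.span {MvPolynomial.eval x Q} ⊔ maximalIdeal S ^ (ℓ + 2) ≠ ⊥ := fun h =>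
    pow_ne_zero (ℓ + 2) h𝔪 (eq_bot_iff.mpr (le_sup_right.trans h.le))
  have hIm : ((affineBlowup.idealSheaf (Ideal.span {MvPolynomial.eval x Q} ⊔ maximalIdeal S ^ (ℓ + 2))).support :
      Set (Spec (.of S))) ⊆ {IsLocalRing.closedPoint S} := fun s hs =>
    Set.mem_singleton_iff.mpr (support_idealSheaf_subset_closedPoint (n := ℓ + 2) le_sup_right s hs)
  set J₀ : (Spec (.of S)).IdealSheafData := affineBlowup.idealSheaf (maximalIdeal S) with hJ₀
  have hσ : IsBlowup (blowup.π J₀) J₀ := blowup.isBlowup J₀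
  haveI : IsProper (blowup.π J₀) := hσ.isProper
  haveI : IsLocallyNoetherian (blowup J₀) := LocallyOfFiniteType.isLocallyNoetherian (blowup.π J₀)
  haveI : IsNoetherian (blowup J₀) := by
    haveI : CompactSpace (blowup J₀) := QuasiCompact.compactSpace_of_compactSpace (blowup.π J₀)
    exact {}
  have hsuppJ₀ : ∀ s : Spec (.of S), s ∈ J₀.support → s = IsLocalRing.closedPoint S := fun s hs =>
    support_idealSheaf_subset_closedPoint (Q := maximalIdeal S) (n := 1) (by rw [pow_one]) s hs
  -- regularity of `X₁`: the centre `V(𝔪~)` is the reduced closed point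
  have hreg : Scheme.IsRegular (blowup J₀) := by
    refine IsBlowup.isRegular_of_isRegular_subscheme (Scheme.isRegular_Spec (.of S)) ?_ hσ
    refine Scheme.isRegular_subscheme_of_forall J₀ fun y hy => ?_
    obtain rfl : y = IsLocalRing.closedPoint S := hsuppJ₀ y hy
    have hJ : stalkIdeal J₀ (IsLocalRing.closedPoint S : Spec (.of S)) = maximalIdeal _ :=
      stalkIdeal_idealSheaf_maximalIdeal_closedPoint
    rw [hJ]
    letI := Ideal.Quotient.field (maximalIdeal ((Spec (.of S)).presheaf.stalk (IsLocalRing.closedPoint S)))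
    infer_instance
  have hfmt := smoothQuadric_format x hx Q hQ ℓ hσ
  -- the two exponent lists on the boundary `[𝓗₁, E₁]`
  set H₁ : (blowup J₀).IdealSheafData :=
    controlledTransform (blowup.π J₀) J₀ (affineBlowup.idealSheaf (Ideal.span {MvPolynomial.eval x Q})) 2 with hH₁
  set E₁ : (blowup J₀).IdealSheafData := J₀.comap (blowup.π J₀) with hE₁
  have hAB : boundaryOf [(H₁, 1), (E₁, 0)] = boundaryOf [(H₁, 0), (E₁, ℓ)] := rfl
  have hover : ∀ y : blowup J₀, y ∈ (monomialIdeal [(H₁, 1), (E₁, 0)] ⊔ monomialIdeal [(H₁, 0), (E₁, ℓ)]).support →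
      blowup.π J₀ y = IsLocalRing.closedPoint S := by
    intro y hy
    have hyI : y ∈ ((affineBlowup.idealSheaf (Ideal.span {MvPolynomial.eval x Q} ⊔ maximalIdeal S ^ (ℓ + 2))).comap
        (blowup.π J₀)).support := by
      rw [hfmt, Scheme.IdealSheafData.support_mul]
      exact Or.inr hy
    rw [Scheme.IdealSheafData.support_comap] at hyI
    exact hIm hyI
  have hsnc : ∀ y : blowup J₀, y ∈ (monomialIdeal [(H₁, 1), (E₁, 0)] ⊔ monomialIdeal [(H₁, 0), (E₁, ℓ)]).support →
      DepthSNC.SNCWithAt (boundaryOf [(H₁, 1), (E₁, 0)]) ⊤ y := fun y hy =>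
    smoothQuadric_sncWithAt_blowup x hx hdim Q hQ hsm y (hover y hy)
  have hC := coneEndCompanion hI hreg ⟨J₀, hσ, fun s hs => Set.mem_singleton_iff.mpr (hsuppJ₀ s hs)⟩
    (hσ.isEffectiveCartier.isLocallyPrincipal.pow 2) [(H₁, 1), (E₁, 0)] [(H₁, 0), (E₁, ℓ)] hAB hsnc hover hfmt
  exact ⟨hC, fun T f hf => atomConclusion_of_companion' hI hC T f hf⟩

end SmoothQuadricRung

/-- **The registered core's binder shape on the member `(Q(x)) + 𝔪^{ℓ+2}`** for a form `Q` of degree `2` with smooth reduced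
quadric (hypotheses of `stub_atomDimFourBlowup`; characteristic, completeness, perfectness of the residue field and the off-fibre
hypothesis unused). [cite: Kollar2007, 3.61] -/
theorem atomDimFourBlowupAt_smoothQuadric (p : ℕ) (_hp : p.Prime) (S : Type) [CommRing S]
    [IsRegularLocalRing S] [CharP S p] [IsAdicComplete (IsLocalRing.maximalIdeal S) S]
    [PerfectField (IsLocalRing.ResidueField S)] (hS : ringKrullDim S = (4 : ℕ))
    (x : Fin 4 → S) (hx : Ideal.span (Set.range x) = IsLocalRing.maximalIdeal S)
    (Q : MvPolynomial (Fin 4) S) (hQ : Q.IsHomogeneous 2)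
    (hsm : ∀ i, Ideal.span (insert (chartPoly Q i) (Set.range fun t => MvPolynomial.pderiv t (chartPoly Q i))) = ⊤) (ℓ : ℕ)
    (T : Scheme.{0}) (f : T ⟶ Spec (.of S))
    (hf : IsBlowup f (affineBlowup.idealSheaf (Ideal.span {MvPolynomial.eval x Q} ⊔ IsLocalRing.maximalIdeal S ^ (ℓ + 2))))
    (_hoff : ∀ t : T, f.base t ≠ IsLocalRing.closedPoint S → IsRegularLocalRing (T.presheaf.stalk t)) :
    ∃ (J : T.IdealSheafData) (T' : Scheme.{0}) (π : T' ⟶ T), J ≠ ⊥ ∧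
      (∀ t : T, t ∈ J.support → f.base t = IsLocalRing.closedPoint S) ∧
      IsBlowup π J ∧ Scheme.IsRegular T' :=
  (smoothQuadricRung_of_ringKrullDim x hx hS Q hQ hsm ℓ).2 T f hf

end ConeDepth

end Summit.ResolutionOfSingularities.ResolutionOfSingularities.Theorems

end
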